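import Literature.AnabelianGeometry.EtaleTheta.Discharge.Sec4Thm44KummerClassConnected
import Literature.AnabelianGeometry.EtaleTheta.BiKummerThm44SubModelConnectedBinjWeak
import Literature.AnabelianGeometry.EtaleTheta.BiKummerThm44SubModelConnectedBaseInjWeak
import HarnessLib

/-!
# [EtTh] Theorem 4.4 (iii), Kummer-class clause (sub-DAG row T44-L16), and Theorem 4.4 IN FULL at the canonical /
# genuine-connected model instances over the WEAK monoid vocabulary `treeMonoidVocabWeak` (proof-only)

S. Mochizuki, *The étale theta function …*, Publ. RIMS **45** (2009) [MochizukiEtTh2009], Thm 4.4 (iii), PDF p.94: "…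
Then the isomorphism `H¹(H_{A₁}, μ_N(A₁)) ⥲ H¹(H_{A₂}, μ_N(A₂))` maps `κ_{f₁} ↦ κ_{f₂}`, i.e., is compatible with the
Kummer classes of [Mzk18], Definition 2.1, (ii)"; proof p.95.

WEAK-VOCABULARY TWIN of the `treeMonoidVocab.{0}`-pinned parts of abc-iut-L2-t3's `Discharge/Sec4Thm44KummerClassModel.lean`
(§Canonical: `Thm44Hyp.preservesKummerClass_mkOfModelCanonical`, row T44-L16, R139) and
`Discharge/Sec4Thm44KummerClassConnected.lean` (`preservesKummerClass_mkOfConnectedTemperoid(_of_hBinj)`,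
`thm44_iii_and_kummerClass_mkOfConnectedTemperoid_of_hBinj`, `thm44_full_mkOfConnectedTemperoid_of_hBinj(′)`).  The
realified data are typed with abc-iut-L2-t3's `treeMonoidVocabWeak` — the vocabulary of the tempered coverings `Ÿ`, `Z_∞`
with infinitely many special-fibre components where [FrdI] Def 2.4 (i)(d) and hence the strong vocabulary's «`Φ₀(Y)`
perf-factorial» fail (cell finding F-L2d2-1) — exactly the objects of the bi-Kummer theory of §§4–5.  The inputs «`C_i`
Frobenioid» / T44-L03 come from the tree's [FrdI] Thm 5.2 (ii) (`isFrobenioid_treeCatVocab_of_isMonoidOn`,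
`isFrobenioid_of_structural`) and abc-iut-w6-d037's weak T44-L03 (`preservesFrobeniusStructure_treeVocabWeak`,
`preservesFrobeniusStructure_mkOfConnectedTemperoid_of_hBinj_treeVocabWeak`); T44-L16 itself is abc-iut-L2-t3's
vocabulary-generic `preservesKummerClass_of` (T44-L09c `galoisCompatible_mkOfConnectedTemperoid`, abc-iut-w5-d013;
T44-L10 (c) `biratCompatible_mkOfModel`, abc-iut-w5-d179), consumed BY NAME:

* `Thm44Hyp.preservesKummerClass_mkOfModelCanonical_treeVocabWeak` ⇐ {Rmk 3.7.2 ×2, `hBmon` ×2, `h9`};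
* `Thm44Hyp.preservesKummerClass_mkOfConnectedTemperoid_treeVocabWeak (hF₁ hF₂ h3)` (any proofs of the standing
  hypotheses) and `…_of_hBinj_treeVocabWeak` ⇐ {`hBinj₁`, `hBinj₂`};
* `Thm44Hyp.thm44_iii_and_kummerClass_mkOfConnectedTemperoid_of_hBinj_treeVocabWeak`,
  **`Thm44Hyp.thm44_full_mkOfConnectedTemperoid_of_hBinj_treeVocabWeak(′)` — Thm 4.4 (i) ∧ (ii) ∧ (iii) IN FULL (saturation
  ∧ Kummer class) ∧ (`N`-th roots) at the genuine connected base `B^temp(Π^tp_X)⁰` over the WEAK vocabulary ⇐ {`hBinj₁`,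
  `hBinj₂`, T44-L15b} and NOTHING ELSE.**
Universe note: Hom- and monoid-universe `0` as in the strong files (Mathlib `groupCohomology`).  Seat abc-iut-L6-t12 (gen
4), cell abc-iut, piece (W11).  PROOF-ONLY (0 defs); nothing of the strong files or of abc-iut-w6-d037's files is edited or
restated.  HONEST FRAMING: refereed pre-IUT material; nothing here bears on [IUTchIII] Cor. 3.12; a model instance is
evidence about OUR typed interface only; typed ≠ proved — here PROVED.
-/

noncomputable section

namespace Literature.AnabelianGeometry.EtaleTheta

open CategoryTheory Opposite Function Literature.AlgebraicGeometry.Frobenioids Literature.AnabelianGeometry.SemiGraphs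

namespace BiKummerSetting

universe u₀ v₀ u

/-! ### §1 The canonical model instances `mkOfModelCanonical` over the weak vocabulary -/

section Canonical

variable {K : Type u₀} [Field K] {K' : Type u₀} [Field K'] {D₀ : Type u₀} [Category.{v₀} D₀]
  {X₁ : SemiGraphs.TemperedArithmeticGroup.{u₀} K} {X₂ : SemiGraphs.TemperedArithmeticGroup.{u₀} K'}
  {D₀' : Type u₀} [Category.{v₀} D₀'] {D₁ D₂ : Type u} [Category.{0} D₁] [Category.{0} D₂]
  {T₁' : RealifiedDivisorMonoids (D₀ := D₀) treeMonoidVocabWeak.{0}}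
  {T₂' : RealifiedDivisorMonoids (D₀ := D₀') treeMonoidVocabWeak.{0}}
  {IsRational₁ IsStrictlyRational₁ : (D₁ᵒᵖ ⥤ CommMonCat.{0}) → Prop}
  {IsRational₂ IsStrictlyRational₂ : (D₂ᵒᵖ ⥤ CommMonCat.{0}) → Prop}
  {tf₁ : TemperedFrobenioid T₁' D₁ (treeCatVocab D₁ IsRational₁ IsStrictlyRational₁)}
  {hZ₁ : tf₁.monoidType = MonoidType.Z} {hP₁ : ∀ A : D₁ᵒᵖ, IsPerfect (tf₁.Φ.carrier A)}
  {IG₁ : D₁ → Prop} {gS₁ : ∀ A : D₁, IG₁ A → (X₁.Pi →* Aut A)}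
  {gSs₁ : ∀ (A : D₁) (hA : IG₁ A), Function.Surjective (gS₁ A hA)}
  {NH₁ : Subgroup (Field.absoluteGaloisGroup K) → tf₁.category → ℕ+ → Prop} {A₀₁ : tf₁.category}
  {hA₀₁ : PreFrobenioid.IsFrobeniusTrivial tf₁.toElem A₀₁} {hA₀₁' : IG₁ A₀₁.base}
  {tf₂ : TemperedFrobenioid T₂' D₂ (treeCatVocab D₂ IsRational₂ IsStrictlyRational₂)}
  {hZ₂ : tf₂.monoidType = MonoidType.Z} {hP₂ : ∀ A : D₂ᵒᵖ, IsPerfect (tf₂.Φ.carrier A)}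
  {IG₂ : D₂ → Prop} {gS₂ : ∀ A : D₂, IG₂ A → (X₂.Pi →* Aut A)}
  {gSs₂ : ∀ (A : D₂) (hA : IG₂ A), Function.Surjective (gS₂ A hA)}
  {NH₂ : Subgroup (Field.absoluteGaloisGroup K') → tf₂.category → ℕ+ → Prop} {A₀₂ : tf₂.category}
  {hA₀₂ : PreFrobenioid.IsFrobeniusTrivial tf₂.toElem A₀₂} {hA₀₂' : IG₂ A₀₂.base}

/-- **T44-L16 at the canonical model instances `mkOfModelCanonical` over the WEAK vocabulary, with `ψ = Ψ^birat`
CONSTRUCTED** ⇐ {Rmk 3.7.2 (`Remark372 D₀ / D₀'`), `hBmon₁ / hBmon₂`, T44-L09c `h9`} — "`C_i` Frobenioid" and T44-L03 being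
theorems at the tree vocabularies (`isFrobenioid_treeCatVocab_of_isMonoidOn`, abc-iut-w6-d037's
`preservesFrobeniusStructure_treeVocabWeak`). [cite: MochizukiEtTh2009, Thm 4.4 (iii) p.94] -/
theorem Thm44Hyp.preservesKummerClass_mkOfModelCanonical_treeVocabWeak
    (h : Thm44Hyp (mkOfModelCanonical X₁ tf₁ hZ₁ hP₁ IG₁ gS₁ gSs₁ NH₁ A₀₁ hA₀₁ hA₀₁')
      (mkOfModelCanonical X₂ tf₂ hZ₂ hP₂ IG₂ gS₂ gSs₂ NH₂ A₀₂ hA₀₂ hA₀₂'))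
    (h372 : TemperedFrobenioid.Remark372 D₀) (h372' : TemperedFrobenioid.Remark372 D₀')
    (hBmon₁ : IsMonoidOn tf₁.ratFnFunctor) (hBmon₂ : IsMonoidOn tf₂.ratFnFunctor) (h9 : h.GaloisCompatible) :
    h.PreservesKummerClass
      (h.psiModel (tf₁.isFrobenioid_treeCatVocab_of_isMonoidOn hBmon₁)
        (tf₂.isFrobenioid_treeCatVocab_of_isMonoidOn hBmon₂)
        (h.preservesFrobeniusStructure_treeVocabWeak h372 h372' hBmon₁ hBmon₂)) h9
      (h.biratCompatible_mkOfModel (tf₁.isFrobenioid_treeCatVocab_of_isMonoidOn hBmon₁)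
        (tf₂.isFrobenioid_treeCatVocab_of_isMonoidOn hBmon₂)
        (h.preservesFrobeniusStructure_treeVocabWeak h372 h372' hBmon₁ hBmon₂)) :=
  h.preservesKummerClass_of _ h9 _

end Canonical

/-! ### §2 The genuine connected base `B^temp(Π^tp_X)⁰` over the weak vocabulary -/

section Connected

variable {K : Type} [Field K] {K' : Type} [Field K'] {X₁ : SemiGraphs.TemperedArithmeticGroup.{0} K}
  {X₂ : SemiGraphs.TemperedArithmeticGroup.{0} K'} {D₀ : Type} [Category.{v₀} D₀] {D₀' : Type}
  [Category.{v₀} D₀'] {T₁ : RealifiedDivisorMonoids (D₀ := D₀) treeMonoidVocabWeak.{0}}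
  {T₂ : RealifiedDivisorMonoids (D₀ := D₀') treeMonoidVocabWeak.{0}}
  {IsRational₁ IsStrictlyRational₁ : ((ConnectedPart (BTemp X₁.Pi))ᵒᵖ ⥤ CommMonCat.{0}) → Prop}
  {IsRational₂ IsStrictlyRational₂ : ((ConnectedPart (BTemp X₂.Pi))ᵒᵖ ⥤ CommMonCat.{0}) → Prop}
  {tf₁ : TemperedFrobenioid T₁ (ConnectedPart (BTemp X₁.Pi))
    (treeCatVocab (ConnectedPart (BTemp X₁.Pi)) IsRational₁ IsStrictlyRational₁)}
  {hZ₁ : tf₁.monoidType = MonoidType.Z} {hP₁ : ∀ A : (ConnectedPart (BTemp X₁.Pi))ᵒᵖ, IsPerfect (tf₁.Φ.carrier A)}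
  {NH₁ : Subgroup (Field.absoluteGaloisGroup K) → tf₁.category → ℕ+ → Prop} {A₁ : tf₁.category}
  {hA₁ : PreFrobenioid.IsFrobeniusTrivial tf₁.toElem A₁} {hA₁' : SemiGraphs.IsGaloisObj A₁.base.obj}
  {tf₂ : TemperedFrobenioid T₂ (ConnectedPart (BTemp X₂.Pi))
    (treeCatVocab (ConnectedPart (BTemp X₂.Pi)) IsRational₂ IsStrictlyRational₂)}
  {hZ₂ : tf₂.monoidType = MonoidType.Z} {hP₂ : ∀ B : (ConnectedPart (BTemp X₂.Pi))ᵒᵖ, IsPerfect (tf₂.Φ.carrier B)}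
  {NH₂ : Subgroup (Field.absoluteGaloisGroup K') → tf₂.category → ℕ+ → Prop} {A₂ : tf₂.category}
  {hA₂ : PreFrobenioid.IsFrobeniusTrivial tf₂.toElem A₂} {hA₂' : SemiGraphs.IsGaloisObj A₂.base.obj}

/-- **T44-L16 AT THE GENUINE CONNECTED BASE `B^temp(Π^tp_X)⁰` over the WEAK vocabulary, with `ψ = Ψ^birat` CONSTRUCTED
(`psiModel`) and NO sub-node input left**: the isomorphism `H¹(H_{A₁}, μ_N(A₁)) ⥲ H¹(H_{A₂}, μ_N(A₂))` induced by `Ψ` maps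
`κ_{f₁} ↦ κ_{f₂}`.  The parameters `hF₁ hF₂ h3` («`C_i` Frobenioid», T44-L03) are print's standing hypotheses, ANY proofs
(the data `T_i` over `treeMonoidVocabWeak` are named in the statement). [cite: MochizukiEtTh2009, Thm 4.4 (iii) p.94] -/
theorem Thm44Hyp.preservesKummerClass_mkOfConnectedTemperoid_treeVocabWeak
    (h : Thm44Hyp (mkOfConnectedTemperoid X₁ tf₁ hZ₁ hP₁ NH₁ A₁ hA₁ hA₁')
      (mkOfConnectedTemperoid X₂ tf₂ hZ₂ hP₂ NH₂ A₂ hA₂ hA₂'))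
    (hF₁ : PreFrobenioid.IsFrobenioid tf₁.toElem) (hF₂ : PreFrobenioid.IsFrobenioid tf₂.toElem)
    (h3 : Thm44Hyp.PreservesFrobeniusStructure (V := treeMonoidVocabWeak.{0}) h) :
    h.PreservesKummerClass (h.psiModel hF₁ hF₂ h3)
      (h.galoisCompatible_mkOfConnectedTemperoid _ _ _ _ _ _ _ _ _ _ _ _ _ _)
      (h.biratCompatible_mkOfModel hF₁ hF₂ h3) :=
  h.preservesKummerClass_of _ _ _

/-- **T44-L16 at the genuine connected base from `hBinj₁ / hBinj₂` ALONE, WEAK vocabulary**: the standing hypotheses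
«`C_i` is a Frobenioid» and T44-L03 supplied from the injectivity of the pull-backs of `B₀^Λ` (abc-iut-L2-t3's
`TemperedFrobenioid.isFrobenioid_of_structural` with [FrdII] Ex 1.3 (i) `connectedPart_isOfFSMType`; abc-iut-w6-d037's
`preservesFrobeniusStructure_mkOfConnectedTemperoid_of_hBinj_treeVocabWeak`). [cite: MochizukiEtTh2009, Thm 4.4 (iii) p.94] -/
theorem Thm44Hyp.preservesKummerClass_mkOfConnectedTemperoid_of_hBinj_treeVocabWeak
    (h : Thm44Hyp (mkOfConnectedTemperoid X₁ tf₁ hZ₁ hP₁ NH₁ A₁ hA₁ hA₁')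
      (mkOfConnectedTemperoid X₂ tf₂ hZ₂ hP₂ NH₂ A₂ hA₂ hA₂'))
    (hBinj₁ : ∀ {Y Y' : D₀ᵒᵖ} (g : Y ⟶ Y'), Injective (T₁.BΛ.map g).hom)
    (hBinj₂ : ∀ {Y Y' : D₀'ᵒᵖ} (g : Y ⟶ Y'), Injective (T₂.BΛ.map g).hom) :
    h.PreservesKummerClass
      (h.psiModel (tf₁.isFrobenioid_of_structural hBinj₁ fun α hα =>
        (QuasiTemperoid.BTempConnected.connectedPart_isOfFSMType (G := X₁.Pi)).isIso_of_isFSM α hα)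
        (tf₂.isFrobenioid_of_structural hBinj₂ fun α hα =>
        (QuasiTemperoid.BTempConnected.connectedPart_isOfFSMType (G := X₂.Pi)).isIso_of_isFSM α hα)
        (h.preservesFrobeniusStructure_mkOfConnectedTemperoid_of_hBinj_treeVocabWeak hBinj₁ hBinj₂))
      (h.galoisCompatible_mkOfConnectedTemperoid _ _ _ _ _ _ _ _ _ _ _ _ _ _)
      (h.biratCompatible_mkOfModel
        (tf₁.isFrobenioid_of_structural hBinj₁ fun α hα =>
          (QuasiTemperoid.BTempConnected.connectedPart_isOfFSMType (G := X₁.Pi)).isIso_of_isFSM α hα)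
        (tf₂.isFrobenioid_of_structural hBinj₂ fun α hα =>
          (QuasiTemperoid.BTempConnected.connectedPart_isOfFSMType (G := X₂.Pi)).isIso_of_isFSM α hα)
        (h.preservesFrobeniusStructure_mkOfConnectedTemperoid_of_hBinj_treeVocabWeak hBinj₁ hBinj₂)) :=
  h.preservesKummerClass_mkOfConnectedTemperoid_treeVocabWeak _ _ _

/-- **[EtTh] Thm 4.4 (iii) IN FULL at the genuine connected base, WEAK vocabulary** — the saturation clause `Thm44_iii` AND
the Kummer-class clause — for the CONSTRUCTED `ψ = psiModel hF₁ hF₂ h3` over ANY proofs of the standing hypotheses,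
⇐ {`hBinj₁`, `hBinj₂`, T44-L15b}. [cite: MochizukiEtTh2009, Thm 4.4 (iii) p.94] -/
theorem Thm44Hyp.thm44_iii_and_kummerClass_mkOfConnectedTemperoid_of_hBinj_treeVocabWeak
    (h : Thm44Hyp (mkOfConnectedTemperoid X₁ tf₁ hZ₁ hP₁ NH₁ A₁ hA₁ hA₁')
      (mkOfConnectedTemperoid X₂ tf₂ hZ₂ hP₂ NH₂ A₂ hA₂ hA₂'))
    (hF₁ : PreFrobenioid.IsFrobenioid tf₁.toElem) (hF₂ : PreFrobenioid.IsFrobenioid tf₂.toElem)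
    (h3 : Thm44Hyp.PreservesFrobeniusStructure (V := treeMonoidVocabWeak.{0}) h)
    (hBinj₁ : ∀ {Y Y' : D₀ᵒᵖ} (g : Y ⟶ Y'), Injective (T₁.BΛ.map g).hom)
    (hBinj₂ : ∀ {Y Y' : D₀'ᵒᵖ} (g : Y ⟶ Y'), Injective (T₂.BΛ.map g).hom) (h15 : h.PreservesNHSaturatedBsFld) :
    Thm44_iii h (h.psiModel hF₁ hF₂ h3) ∧
      h.PreservesKummerClass (h.psiModel hF₁ hF₂ h3)
        (h.galoisCompatible_mkOfConnectedTemperoid _ _ _ _ _ _ _ _ _ _ _ _ _ _)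
        (h.biratCompatible_mkOfModel hF₁ hF₂ h3) :=
  ⟨h.thm44_iii_mkOfConnectedTemperoid_of_hBinj_treeVocabWeak hF₁ hF₂ h3 hBinj₁ hBinj₂ h15,
    h.preservesKummerClass_mkOfConnectedTemperoid_treeVocabWeak hF₁ hF₂ h3⟩

/-- **[EtTh] Thm 4.4 (i) ∧ (ii) ∧ (iii) IN FULL (saturation ∧ Kummer class) ∧ (`N`-th roots) AT THE GENUINE CONNECTED
BASE `B^temp(Π^tp_X)⁰` over the WEAK vocabulary ⇐ {`hBinj₁`, `hBinj₂`, T44-L15b} and NOTHING ELSE** — abc-iut-w6-d037's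
`thm44_mkOfConnectedTemperoid_of_hBinj_treeVocabWeak` with the Kummer-class clause of (iii) added; every [SemiAnbd] /
[FrdI] / [FrdII] input of the printed proof (p.95) is a theorem of the tree at this base, NO plan/FACT-LIST fact and NO
perf-factorial binder is an input (the realified data are the weakly-perf-factorial ones of `Ÿ` / `Z_∞`).  `hF₁ hF₂ h3` are
ANY proofs of the standing hypotheses. [cite: MochizukiEtTh2009, Thm 4.4 p.94] -/
theorem Thm44Hyp.thm44_full_mkOfConnectedTemperoid_of_hBinj_treeVocabWeak
    (h : Thm44Hyp (mkOfConnectedTemperoid X₁ tf₁ hZ₁ hP₁ NH₁ A₁ hA₁ hA₁')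
      (mkOfConnectedTemperoid X₂ tf₂ hZ₂ hP₂ NH₂ A₂ hA₂ hA₂'))
    (hF₁ : PreFrobenioid.IsFrobenioid tf₁.toElem) (hF₂ : PreFrobenioid.IsFrobenioid tf₂.toElem)
    (h3 : Thm44Hyp.PreservesFrobeniusStructure (V := treeMonoidVocabWeak.{0}) h)
    (hBinj₁ : ∀ {Y Y' : D₀ᵒᵖ} (g : Y ⟶ Y'), Injective (T₁.BΛ.map g).hom)
    (hBinj₂ : ∀ {Y Y' : D₀'ᵒᵖ} (g : Y ⟶ Y'), Injective (T₂.BΛ.map g).hom) (h15 : h.PreservesNHSaturatedBsFld) :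
    Thm44_i h ∧ Thm44_ii h (h.psiModel hF₁ hF₂ h3) ∧ Thm44_iii h (h.psiModel hF₁ hF₂ h3) ∧
      h.PreservesKummerClass (h.psiModel hF₁ hF₂ h3)
        (h.galoisCompatible_mkOfConnectedTemperoid _ _ _ _ _ _ _ _ _ _ _ _ _ _)
        (h.biratCompatible_mkOfModel hF₁ hF₂ h3) ∧
      h.PreservesNthRoots (h.psiModel hF₁ hF₂ h3) (fun φ f => tf₁.pullFracModel φ f)
        (fun φ f => tf₂.pullFracModel φ f) := by
  obtain ⟨h₁, h₂, h₃, h₄⟩ := h.thm44_mkOfConnectedTemperoid_of_hBinj_treeVocabWeak hF₁ hF₂ h3 hBinj₁ hBinj₂ h15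
  exact ⟨h₁, h₂, h₃, h.preservesKummerClass_mkOfConnectedTemperoid_treeVocabWeak hF₁ hF₂ h3, h₄⟩

/-- **The same with the ψ-slot proofs themselves supplied from `hBinj`** — literally ⇐ {`hBinj₁`, `hBinj₂`, T44-L15b}, WEAK
vocabulary. [cite: MochizukiEtTh2009, Thm 4.4 p.94] -/
theorem Thm44Hyp.thm44_full_mkOfConnectedTemperoid_of_hBinj_treeVocabWeak'
    (h : Thm44Hyp (mkOfConnectedTemperoid X₁ tf₁ hZ₁ hP₁ NH₁ A₁ hA₁ hA₁')
      (mkOfConnectedTemperoid X₂ tf₂ hZ₂ hP₂ NH₂ A₂ hA₂ hA₂'))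
    (hBinj₁ : ∀ {Y Y' : D₀ᵒᵖ} (g : Y ⟶ Y'), Injective (T₁.BΛ.map g).hom)
    (hBinj₂ : ∀ {Y Y' : D₀'ᵒᵖ} (g : Y ⟶ Y'), Injective (T₂.BΛ.map g).hom) (h15 : h.PreservesNHSaturatedBsFld) :
    Thm44_i (V := treeMonoidVocabWeak.{0}) h ∧
      Thm44_ii h (h.psiModel (tf₁.isFrobenioid_of_structural hBinj₁ fun α hα =>
        (QuasiTemperoid.BTempConnected.connectedPart_isOfFSMType (G := X₁.Pi)).isIso_of_isFSM α hα)
        (tf₂.isFrobenioid_of_structural hBinj₂ fun α hα =>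
        (QuasiTemperoid.BTempConnected.connectedPart_isOfFSMType (G := X₂.Pi)).isIso_of_isFSM α hα)
        (h.preservesFrobeniusStructure_mkOfConnectedTemperoid_of_hBinj_treeVocabWeak hBinj₁ hBinj₂)) ∧
      Thm44_iii h (h.psiModel (tf₁.isFrobenioid_of_structural hBinj₁ fun α hα =>
        (QuasiTemperoid.BTempConnected.connectedPart_isOfFSMType (G := X₁.Pi)).isIso_of_isFSM α hα)
        (tf₂.isFrobenioid_of_structural hBinj₂ fun α hα =>
        (QuasiTemperoid.BTempConnected.connectedPart_isOfFSMType (G := X₂.Pi)).isIso_of_isFSM α hα)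
        (h.preservesFrobeniusStructure_mkOfConnectedTemperoid_of_hBinj_treeVocabWeak hBinj₁ hBinj₂)) ∧
      h.PreservesKummerClass (h.psiModel (tf₁.isFrobenioid_of_structural hBinj₁ fun α hα =>
        (QuasiTemperoid.BTempConnected.connectedPart_isOfFSMType (G := X₁.Pi)).isIso_of_isFSM α hα)
        (tf₂.isFrobenioid_of_structural hBinj₂ fun α hα =>
        (QuasiTemperoid.BTempConnected.connectedPart_isOfFSMType (G := X₂.Pi)).isIso_of_isFSM α hα)
        (h.preservesFrobeniusStructure_mkOfConnectedTemperoid_of_hBinj_treeVocabWeak hBinj₁ hBinj₂))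
        (h.galoisCompatible_mkOfConnectedTemperoid _ _ _ _ _ _ _ _ _ _ _ _ _ _)
        (h.biratCompatible_mkOfModel
          (tf₁.isFrobenioid_of_structural hBinj₁ fun α hα =>
            (QuasiTemperoid.BTempConnected.connectedPart_isOfFSMType (G := X₁.Pi)).isIso_of_isFSM α hα)
          (tf₂.isFrobenioid_of_structural hBinj₂ fun α hα =>
            (QuasiTemperoid.BTempConnected.connectedPart_isOfFSMType (G := X₂.Pi)).isIso_of_isFSM α hα)
          (h.preservesFrobeniusStructure_mkOfConnectedTemperoid_of_hBinj_treeVocabWeak hBinj₁ hBinj₂)) ∧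
      h.PreservesNthRoots (h.psiModel (tf₁.isFrobenioid_of_structural hBinj₁ fun α hα =>
        (QuasiTemperoid.BTempConnected.connectedPart_isOfFSMType (G := X₁.Pi)).isIso_of_isFSM α hα)
        (tf₂.isFrobenioid_of_structural hBinj₂ fun α hα =>
        (QuasiTemperoid.BTempConnected.connectedPart_isOfFSMType (G := X₂.Pi)).isIso_of_isFSM α hα)
        (h.preservesFrobeniusStructure_mkOfConnectedTemperoid_of_hBinj_treeVocabWeak hBinj₁ hBinj₂))
        (fun φ f => tf₁.pullFracModel φ f) (fun φ f => tf₂.pullFracModel φ f) :=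
  h.thm44_full_mkOfConnectedTemperoid_of_hBinj_treeVocabWeak _ _ _ hBinj₁ hBinj₂ h15

end Connected


/-! ### §3 (v2 append) The base-image form `hBD` of record (census A9), weak vocabulary — abc-iut-w5-d179's weak
supplier `thm44_mkOfConnectedTemperoid_of_baseInj_treeVocabWeak` (p441501) with the Kummer-class clause added -/

section ConnectedBaseInj

variable {K : Type} [Field K] {K' : Type} [Field K'] {X₁ : SemiGraphs.TemperedArithmeticGroup.{0} K}
  {X₂ : SemiGraphs.TemperedArithmeticGroup.{0} K'} {D₀ : Type} [Category.{v₀} D₀] {D₀' : Type}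
  [Category.{v₀} D₀'] {T₁ : RealifiedDivisorMonoids (D₀ := D₀) treeMonoidVocabWeak.{0}}
  {T₂ : RealifiedDivisorMonoids (D₀ := D₀') treeMonoidVocabWeak.{0}}
  {IsRational₁ IsStrictlyRational₁ : ((ConnectedPart (BTemp X₁.Pi))ᵒᵖ ⥤ CommMonCat.{0}) → Prop}
  {IsRational₂ IsStrictlyRational₂ : ((ConnectedPart (BTemp X₂.Pi))ᵒᵖ ⥤ CommMonCat.{0}) → Prop}
  {tf₁ : TemperedFrobenioid T₁ (ConnectedPart (BTemp X₁.Pi))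
    (treeCatVocab (ConnectedPart (BTemp X₁.Pi)) IsRational₁ IsStrictlyRational₁)}
  {hZ₁ : tf₁.monoidType = MonoidType.Z} {hP₁ : ∀ A : (ConnectedPart (BTemp X₁.Pi))ᵒᵖ, IsPerfect (tf₁.Φ.carrier A)}
  {NH₁ : Subgroup (Field.absoluteGaloisGroup K) → tf₁.category → ℕ+ → Prop} {A₁ : tf₁.category}
  {hA₁ : PreFrobenioid.IsFrobeniusTrivial tf₁.toElem A₁} {hA₁' : SemiGraphs.IsGaloisObj A₁.base.obj}
  {tf₂ : TemperedFrobenioid T₂ (ConnectedPart (BTemp X₂.Pi))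
    (treeCatVocab (ConnectedPart (BTemp X₂.Pi)) IsRational₂ IsStrictlyRational₂)}
  {hZ₂ : tf₂.monoidType = MonoidType.Z} {hP₂ : ∀ B : (ConnectedPart (BTemp X₂.Pi))ᵒᵖ, IsPerfect (tf₂.Φ.carrier B)}
  {NH₂ : Subgroup (Field.absoluteGaloisGroup K') → tf₂.category → ℕ+ → Prop} {A₂ : tf₂.category}
  {hA₂ : PreFrobenioid.IsFrobeniusTrivial tf₂.toElem A₂} {hA₂' : SemiGraphs.IsGaloisObj A₂.base.obj}

/-- **[EtTh] Thm 4.4 (i) ∧ (ii) ∧ (iii) IN FULL (saturation ∧ Kummer class) ∧ (`N`-th roots) AT THE GENUINE CONNECTED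
BASE over the WEAK vocabulary ⇐ {`hBD₁`, `hBD₂`, T44-L15b} and NOTHING ELSE** — the base-image form of record (census A9;
the weak twin of abc-iut-L2-t3's `thm44_full_mkOfConnectedTemperoid_of_baseInj`, p439960): abc-iut-w5-d179's
`thm44_mkOfConnectedTemperoid_of_baseInj_treeVocabWeak` (p441501) with the Kummer-class clause of (iii) added
(`ψ = psiModel` over ANY proofs `hF₁ hF₂ h3` of the standing hypotheses). [cite: MochizukiEtTh2009, Thm 4.4 p.94] -/
theorem Thm44Hyp.thm44_full_mkOfConnectedTemperoid_of_baseInj_treeVocabWeak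
    (h : Thm44Hyp (mkOfConnectedTemperoid X₁ tf₁ hZ₁ hP₁ NH₁ A₁ hA₁ hA₁')
      (mkOfConnectedTemperoid X₂ tf₂ hZ₂ hP₂ NH₂ A₂ hA₂ hA₂'))
    (hF₁ : PreFrobenioid.IsFrobenioid tf₁.toElem) (hF₂ : PreFrobenioid.IsFrobenioid tf₂.toElem)
    (h3 : Thm44Hyp.PreservesFrobeniusStructure (V := treeMonoidVocabWeak.{0}) h)
    (hBD₁ : ∀ {A B : ConnectedPart (BTemp X₁.Pi)} (α : B ⟶ A), Injective (T₁.BΛ.map (tf₁.base.map α).op).hom)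
    (hBD₂ : ∀ {A B : ConnectedPart (BTemp X₂.Pi)} (α : B ⟶ A), Injective (T₂.BΛ.map (tf₂.base.map α).op).hom)
    (h15 : h.PreservesNHSaturatedBsFld) :
    Thm44_i h ∧ Thm44_ii h (h.psiModel hF₁ hF₂ h3) ∧ Thm44_iii h (h.psiModel hF₁ hF₂ h3) ∧
      h.PreservesKummerClass (h.psiModel hF₁ hF₂ h3)
        (h.galoisCompatible_mkOfConnectedTemperoid _ _ _ _ _ _ _ _ _ _ _ _ _ _)
        (h.biratCompatible_mkOfModel hF₁ hF₂ h3) ∧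
      h.PreservesNthRoots (h.psiModel hF₁ hF₂ h3) (fun φ f => tf₁.pullFracModel φ f)
        (fun φ f => tf₂.pullFracModel φ f) := by
  obtain ⟨h₁, h₂, h₃, h₄⟩ :=
    Thm44Hyp.thm44_mkOfConnectedTemperoid_of_baseInj_treeVocabWeak tf₁ hZ₁ hP₁ NH₁ A₁ hA₁ hA₁' tf₂ hZ₂ hP₂ NH₂ A₂
      hA₂ hA₂' h hF₁ hF₂ h3 hBD₁ hBD₂ h15
  exact ⟨h₁, h₂, h₃, h.preservesKummerClass_mkOfConnectedTemperoid_treeVocabWeak hF₁ hF₂ h3, h₄⟩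

/-- **The same with every ψ-slot proof supplied from `hBD`** — literally ⇐ {`hBD₁`, `hBD₂`, T44-L15b}, WEAK vocabulary
(`isFrobenioid_connectedPart_of_baseInj`, abc-iut-w5-d179's `preservesFrobeniusStructure_mkOfConnectedTemperoid_of_baseInj_treeVocabWeak`).
[cite: MochizukiEtTh2009, Thm 4.4 p.94] -/
theorem Thm44Hyp.thm44_full_mkOfConnectedTemperoid_of_baseInj_treeVocabWeak'
    (h : Thm44Hyp (mkOfConnectedTemperoid X₁ tf₁ hZ₁ hP₁ NH₁ A₁ hA₁ hA₁')
      (mkOfConnectedTemperoid X₂ tf₂ hZ₂ hP₂ NH₂ A₂ hA₂ hA₂'))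
    (hBD₁ : ∀ {A B : ConnectedPart (BTemp X₁.Pi)} (α : B ⟶ A), Injective (T₁.BΛ.map (tf₁.base.map α).op).hom)
    (hBD₂ : ∀ {A B : ConnectedPart (BTemp X₂.Pi)} (α : B ⟶ A), Injective (T₂.BΛ.map (tf₂.base.map α).op).hom)
    (h15 : h.PreservesNHSaturatedBsFld) :
    Thm44_i (V := treeMonoidVocabWeak.{0}) h ∧
      Thm44_ii h (h.psiModel (tf₁.isFrobenioid_connectedPart_of_baseInj hBD₁)
        (tf₂.isFrobenioid_connectedPart_of_baseInj hBD₂)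
        (h.preservesFrobeniusStructure_mkOfConnectedTemperoid_of_baseInj_treeVocabWeak tf₁ hZ₁ hP₁ NH₁ A₁ hA₁ hA₁'
          tf₂ hZ₂ hP₂ NH₂ A₂ hA₂ hA₂' hBD₁ hBD₂)) ∧
      Thm44_iii h (h.psiModel (tf₁.isFrobenioid_connectedPart_of_baseInj hBD₁)
        (tf₂.isFrobenioid_connectedPart_of_baseInj hBD₂)
        (h.preservesFrobeniusStructure_mkOfConnectedTemperoid_of_baseInj_treeVocabWeak tf₁ hZ₁ hP₁ NH₁ A₁ hA₁ hA₁'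
          tf₂ hZ₂ hP₂ NH₂ A₂ hA₂ hA₂' hBD₁ hBD₂)) ∧
      h.PreservesKummerClass (h.psiModel (tf₁.isFrobenioid_connectedPart_of_baseInj hBD₁)
        (tf₂.isFrobenioid_connectedPart_of_baseInj hBD₂)
        (h.preservesFrobeniusStructure_mkOfConnectedTemperoid_of_baseInj_treeVocabWeak tf₁ hZ₁ hP₁ NH₁ A₁ hA₁ hA₁'
          tf₂ hZ₂ hP₂ NH₂ A₂ hA₂ hA₂' hBD₁ hBD₂))
        (h.galoisCompatible_mkOfConnectedTemperoid _ _ _ _ _ _ _ _ _ _ _ _ _ _)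
        (h.biratCompatible_mkOfModel (tf₁.isFrobenioid_connectedPart_of_baseInj hBD₁)
          (tf₂.isFrobenioid_connectedPart_of_baseInj hBD₂)
          (h.preservesFrobeniusStructure_mkOfConnectedTemperoid_of_baseInj_treeVocabWeak tf₁ hZ₁ hP₁ NH₁ A₁ hA₁ hA₁'
            tf₂ hZ₂ hP₂ NH₂ A₂ hA₂ hA₂' hBD₁ hBD₂)) ∧
      h.PreservesNthRoots (h.psiModel (tf₁.isFrobenioid_connectedPart_of_baseInj hBD₁)
        (tf₂.isFrobenioid_connectedPart_of_baseInj hBD₂)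
        (h.preservesFrobeniusStructure_mkOfConnectedTemperoid_of_baseInj_treeVocabWeak tf₁ hZ₁ hP₁ NH₁ A₁ hA₁ hA₁'
          tf₂ hZ₂ hP₂ NH₂ A₂ hA₂ hA₂' hBD₁ hBD₂))
        (fun φ f => tf₁.pullFracModel φ f) (fun φ f => tf₂.pullFracModel φ f) :=
  h.thm44_full_mkOfConnectedTemperoid_of_baseInj_treeVocabWeak _ _ _ hBD₁ hBD₂ h15

end ConnectedBaseInj

end BiKummerSetting

end Literature.AnabelianGeometry.EtaleTheta

end
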